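import Mathlib
import Literature.Geometry.Riemannian.LowEntropyHypersurfacesFour
import Literature.Geometry.Riemannian.SphericalCylinderEntropy
import Summits.SmoothPoincare4.SmoothPoincare4.Theses.CylinderEntropy

/-!
# Sketch — crux-ideate stmt-SmoothPoincare4-7632 (`CylinderEntropy.SliceIsolation`), ideator 2, round 1

(gen 1 part: cards `median-sheet-isoperimetric-isotopy`, `conformal-kernel-domination`; the gen 2 part for card
`reifenberg-stopping` follows in a second namespace below.)

First lemmas of the two crux idea cards, typed over existing declarations (nothing proved here):

* card `median-sheet-isoperimetric-isotopy`: `CylinderGradientFloor` (the load-bearing lemma GF_N) and its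
  Gauss-space shadow `GaussianBarycentreFloor` (Eldan 2015 / Barchiesi–Brancolini–Julin 2017, restated in
  heat-kernel units on `ℝ⁵`);
* card `conformal-kernel-domination`: `EntropyDomination`, its proved-by-hand centre-zero case
  `CentreZeroDomination`, and the transfer shape `ConformalTransfer` ending in the crux decl BY NAME.
-/

open scoped BigOperators Manifold ContDiff ENNReal Topology
open MeasureTheory Set

namespace Summit.SmoothPoincare4.SmoothPoincare4.Cruxes.SliceIsolation.Sketch

local notation "E5" => EuclideanSpace ℝ (Fin 5)
local notation "E6" => EuclideanSpace ℝ (Fin 6)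

/-- The round cylinder `N = S⁴ × ℝ ⊂ ℝ⁶`, exactly as typed in the route items. -/
def cylN : Set E6 := {z | ∑ i : Fin 5, z (Fin.castSucc i) ^ 2 = 1}

/-- The route's slice-normalised kernel `𝔥(τ, ⟨z', p'⟩) · e^{-(z₅ - p₅)²/4τ}` (Gegenbauer series form, verbatim
from `CylinderEntropy.SliceIsolation`), as a real function of scale `τ`, centre `p` and point `z`. -/
noncomputable def cylKernel (τ : ℝ) (p z : E6) : ℝ :=
  (∑' k : ℕ, Real.exp (-((k : ℝ) * ((k : ℝ) + 3)) * τ) * ((2 * (k : ℝ) + 3) / 3) *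
      ∑ l ∈ Finset.range (k / 2 + 1), (-1 : ℝ) ^ l *
        (∏ j ∈ Finset.range (k - l), ((3 : ℝ) / 2 + (j : ℝ))) /
          (((l.factorial : ℕ) : ℝ) * (((k - 2 * l).factorial : ℕ) : ℝ)) *
        (2 * ∑ i : Fin 5, z (Fin.castSucc i) * p (Fin.castSucc i)) ^ (k - 2 * l)) *
    Real.exp (-((z 5 - p 5) ^ 2) / (4 * τ))

/-- The typed cylinder Gaussian area `F̂_{p,τ}(A)` of `A ⊆ N` (the body of the route's `⨆`). -/
noncomputable def cylArea (p : E6) (τ : ℝ) (A : Set E6) : ℝ≥0∞ :=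
  (μH[4] (Metric.sphere (0 : E5) 1))⁻¹ * ∫⁻ z in A, ENNReal.ofReal (cylKernel τ p z) ∂μH[4]

/-- The typed cylinder entropy `λ_cyl(A) = ⨆_{p ∈ N, τ > 0} F̂_{p,τ}(A)`. -/
noncomputable def cylEntropy (A : Set E6) : ℝ≥0∞ :=
  ⨆ (p : E6) (_ : ∑ i : Fin 5, p (Fin.castSucc i) ^ 2 = 1) (τ : ℝ) (_ : 0 < τ), cylArea p τ A

/-! ## Card `median-sheet-isoperimetric-isotopy` -/

/-- Caloric mollification of the indicator of `U ⊆ N` at scale `τ`, evaluated at the centre `p`: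
`u_τ(p) = ∫_U ρ^N_τ(p, z) dvol_N(z) = (∫_N K)⁻¹ ∫_U K` for the typed kernel `K = 𝔥 · e^{-(Δs)²/4τ}` (the heat kernel of `N`
has total mass one, so self-normalising by `∫_N K ∂μH[5]` is exact whatever the normalisation of `μH[5]`). -/
noncomputable def caloric (U : Set E6) (τ : ℝ) (p : E6) : ℝ :=
  -- SELF-NORMALISED (gen-2 fix after TRIAGE-r1-2: Mathlib's `μH[d]` is un-normalised, so dividing a `μH[5]`-integral
  -- by `μH[4](S⁴)·√(4πτ)` puts the "median" at the wrong level 4/15; dividing by the total kernel mass over `N` is exact):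
  (∫ z in cylN, cylKernel τ p z ∂μH[5])⁻¹ * ∫ z in U, cylKernel τ p z ∂μH[5]

/-- Boundary of `U ⊆ N` relative to `N`. -/
def relFrontier (U : Set E6) : Set E6 := cylN ∩ closure U ∩ closure (cylN \ U)

/-- **GF_N — the cylinder gradient floor (load-bearing lemma of the median-sheet line), positivity form.** There are
universal `ε₀, θ₀ > 0` such that for every region `U ⊆ N`, every MEDIAN centre `p ∈ N` (`u_τ(p) = 1/2`) and every scale
`τ > 0` at which the typed cylinder Gaussian area of the relative boundary is `≤ 1 + ε₀`, the caloric function has a unit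
tangent direction `v ∈ T_pN` with `∂_v u_τ(p) ≥ θ₀ (4πτ)^{-1/2}` (horizontal half-cylinders `{s < s_p}` give exactly
`(4πτ)^{-1/2}`, the Bakry–Émery maximum). Only this positivity is needed for the median-sheet isotopy. -/
def CylinderGradientFloor : Prop :=
  ∃ ε₀ θ₀ : ℝ, 0 < ε₀ ∧ 0 < θ₀ ∧
    ∀ (U : Set E6) (p : E6) (τ : ℝ), U ⊆ cylN → MeasurableSet U → p ∈ cylN → 0 < τ →
      caloric U τ p = 1 / 2 →
      cylArea p τ (relFrontier U) ≤ ENNReal.ofReal (1 + ε₀) →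
      DifferentiableAt ℝ (caloric U τ) p ∧
        ∃ v : E6, ∑ i : Fin 5, v (Fin.castSucc i) * p (Fin.castSucc i) = 0 ∧ ‖v‖ = 1 ∧
          θ₀ * (Real.sqrt (4 * Real.pi * τ))⁻¹ ≤ (fderiv ℝ (caloric U τ) p) v

/-- **GF_N, sharp (stability) form — the natural conjecture: quantitative stability of the Bakry–Ledoux heat-kernel
isoperimetric inequality on `S⁴ × ℝ` in barycentric form.** A universal modulus `ω → 0`: cylinder area `≤ 1 + ε` at a
median centre forces `∂_v u_τ(p) ≥ (1 - ω ε)(4πτ)^{-1/2}`. -/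
def CylinderGradientFloorSharp : Prop :=
  ∃ modulus : ℝ → ℝ, Filter.Tendsto modulus (𝓝[≥] 0) (𝓝 0) ∧
    ∀ (U : Set E6) (p : E6) (τ ε : ℝ), U ⊆ cylN → MeasurableSet U → p ∈ cylN → 0 < τ → 0 ≤ ε →
      caloric U τ p = 1 / 2 →
      cylArea p τ (relFrontier U) ≤ ENNReal.ofReal (1 + ε) →
      DifferentiableAt ℝ (caloric U τ) p ∧
        ∃ v : E6, ∑ i : Fin 5, v (Fin.castSucc i) * p (Fin.castSucc i) = 0 ∧ ‖v‖ = 1 ∧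
          (1 - modulus ε) * (Real.sqrt (4 * Real.pi * τ))⁻¹ ≤ (fderiv ℝ (caloric U τ) p) v

/-- **Bakry–Ledoux on the cylinder at median centres (known inequality, Ric_N ≥ 0): `F̂_{p,τ}(∂U) ≥ 1` whenever
`u_τ(p) = 1/2`** — in particular `λ_cyl ≥ 1` on every closed separating hypersurface (a second proof of the route's floor).
[Bakry–Ledoux 1996, applied to `f = 1_U`; profile value `I(1/2) = 1`.] -/
def BakryLedouxMedianFloor : Prop :=
  ∀ (U : Set E6) (p : E6) (τ : ℝ), U ⊆ cylN → MeasurableSet U → p ∈ cylN → 0 < τ →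
    caloric U τ p = 1 / 2 → 1 ≤ cylArea p τ (relFrontier U)

/-- Heat kernel of `ℝ⁵` at time `τ` centred at `p`: `(4πτ)^{-5/2} e^{-‖y-p‖²/4τ}`. -/
noncomputable def heatKernel5 (p : E5) (τ : ℝ) (y : E5) : ℝ :=
  ((4 * Real.pi * τ) ^ ((5 : ℝ) / 2))⁻¹ * Real.exp (-(‖y - p‖ ^ 2) / (4 * τ))

/-- **Gauss-space shadow of GF_N (known: Eldan 2015; Barchiesi–Brancolini–Julin 2017, linear control of the
barycentric asymmetry by the Gaussian isoperimetric deficit), in heat-kernel units on `ℝ⁵`.** If `E` has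
heat-kernel measure `1/2` seen from `p` and heat-kernel perimeter at most `(1+ε)` times that of a half-space through
`p`, then its heat-kernel barycentre seen from `p` has length at least `(1 - Cε) √(τ/π)` (half-spaces through `p`
give exactly `√(τ/π)`); equivalently `|∇(e^{τΔ} 1_E)(p)| ≥ (1 - Cε)(4πτ)^{-1/2}`. -/
def GaussianBarycentreFloor : Prop :=
  ∃ C : ℝ, 0 < C ∧ ∀ (E : Set E5) (p : E5) (τ ε : ℝ), MeasurableSet E → 0 < τ → 0 ≤ ε →
    ∫ y in E, heatKernel5 p τ y = 1 / 2 →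
    -- perimeter side SELF-NORMALISED by the hyperplane through `p` (gen-2 fix after TRIAGE-r1-2: un-normalised `μH[4]`
    -- against `volume` made the old hypothesis unsatisfiable); `frontier E` stands in for the reduced boundary.
    ∫⁻ y in frontier E, ENNReal.ofReal (heatKernel5 p τ y) ∂μH[4] ≤
      ENNReal.ofReal (1 + ε) * ∫⁻ y in {y : E5 | y 0 = p 0}, ENNReal.ofReal (heatKernel5 p τ y) ∂μH[4] →
    (1 - C * ε) * Real.sqrt (τ / Real.pi) ≤ ‖∫ y in E, heatKernel5 p τ y • (y - p)‖

/-! ## Card `conformal-kernel-domination` -/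

/-- The conformal diffeomorphism `Φ : N → ℝ⁵ ∖ {0}`, `Φ(x, s) = eˢ x`, written on all of `ℝ⁶`. -/
noncomputable def conformalMap (z : E6) : E5 :=
  WithLp.toLp 2 (fun i : Fin 5 => Real.exp (z 5) * z (Fin.castSucc i))

open Literature.Geometry.Riemannian in
/-- **ENTROPY DOMINATION (first lemma of the conformal line).** The Colding–Minicozzi entropy of the conformal
image of any `A ⊆ N` is at most `λ(S⁴) · λ_cyl(A)` (tree `gaussianEntropy 4`; `λ(S⁴)` written as the entropy of the
unit round sphere, so normalisations cancel). Conjectured via pointwise domination of the pulled-back Euclidean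
kernels `(4πτ)^{-2} e^{4s} e^{-|eˢx - y|²/4τ}` by superpositions of cylinder kernels of total mass `λ(S⁴)`. -/
def EntropyDomination : Prop :=
  ∀ A : Set E6, A ⊆ cylN → MeasurableSet A →
    gaussianEntropy 4 (conformalMap '' A) ≤ gaussianEntropy 4 (Metric.sphere (0 : E5) 1) * cylEntropy A

open Literature.Geometry.Riemannian in
/-- **Centre-zero case (proved by hand in the card: `max_s vol(S⁴)(4πτ)^{-2} e^{4s - e^{2s}/4τ} = (32/3)e^{-2} = λ(S⁴)`,
so `F_{0,τ}(Φ A) ≤ λ(S⁴) · area(A)/vol(S⁴) ≤ λ(S⁴) · λ_cyl(A)`).** -/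
def CentreZeroDomination : Prop :=
  ∀ A : Set E6, A ⊆ cylN → MeasurableSet A → ∀ τ : ℝ, 0 < τ →
    gaussianArea 4 (0 : E5) τ (conformalMap '' A) ≤ gaussianEntropy 4 (Metric.sphere (0 : E5) 1) * cylEntropy A

open Literature.Geometry.Riemannian in
/-- **Transfer shape.** Domination + the tree fact CMS Cor. 1.5 (b) (`n = 4`, simply connected, `λ ≤ λ(S²×ℝ²) = 4/e`)
+ the numerical identity `λ(S⁴) · (3e/8) = 4/e` give the crux with the explicit `1 + ε = 3e/8 = 1.01936`.
(The conclusion is the route decl by name; the skeleton proof is crux-plan business.) -/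
def ConformalTransfer : Prop :=
  EntropyDomination →
  ChodoshMantoulidisSchulze2025_lowEntropy_sphere_four →
  gaussianEntropy 4 (Metric.sphere (0 : E5) 1) * ENNReal.ofReal (3 * Real.exp 1 / 8) ≤
      gaussianEntropy 4 (shrinkingCylinder 4 2) →
  Summit.SmoothPoincare4.SmoothPoincare4.Theses.CylinderEntropy.SliceIsolation

end Summit.SmoothPoincare4.SmoothPoincare4.Cruxes.SliceIsolation.Sketch

/-!
# Sketch — crux-ideate stmt-SmoothPoincare4-7632 (`CylinderEntropy.SliceIsolation`), ideator 2, round 1,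
# card `reifenberg-stopping` (third card of this ideator; gen 2)

First lemmas of the FLATNESS LINE, typed over existing declarations (nothing proved here):

* `IsReifFlat A δ r₀` — extrinsic two-sided Reifenberg flatness of `A ⊆ ℝ⁶` w.r.t. 4-planes at all centres
  `x ∈ A` and scales `r ≤ r₀`;
* `NearSlice A η` — `A` lies in the slab `|z₅ - t₀| ≤ η` and every point of the slice `S⁴ × {t₀}` is `η`-close to `A`;
* `SmoothReifenbergRecognition` — THE LEVER (F4): a closed connected smooth 4-manifold smoothly embedded in
  `N = S⁴ × ℝ ⊂ ℝ⁶`, `δ₀`-Reifenberg flat below `r₀` and `η₀`-near a slice, is diffeomorphic to `S⁴`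
  (Reifenberg's construction from the slice, truncated at the embedding's own `C¹` scale: Cheeger–Colding 1997
  App. 1, proof of Thm A.1.2 (vi) + (A.1.17); David–Toro 2012 Thm 2.15 / Prop 5.4 for the extrinsic steps);
* `EntropyLowerDensity`, `EntropyFlatness` (F1) and `SlabConfinement` (F2) — the two entropy lemmas feeding it,
  stated with the tree's `Literature.Geometry.Riemannian.SphericalCylinderEntropy.cylEntropy` (= the route's `⨆`
  verbatim);
* `FlatSandwichTransfer` — the transfer shape ending in the crux decl BY NAME.
-/

open scoped BigOperators Manifold ContDiff ENNReal Topology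
open MeasureTheory Set Literature.Geometry.Riemannian.SphericalCylinderEntropy

namespace Summit.SmoothPoincare4.SmoothPoincare4.Cruxes.SliceIsolation.ReifenbergStopping

local notation "E5" => EuclideanSpace ℝ (Fin 5)
local notation "E6" => EuclideanSpace ℝ (Fin 6)

/-- The round cylinder `N = S⁴ × ℝ ⊂ ℝ⁶`, exactly as typed in the route items. -/
def cylN : Set E6 := {z | ∑ i : Fin 5, z (Fin.castSucc i) ^ 2 = 1}

/-- The typed end-separation predicate of the route items (no path in `N ∖ A` from height `≤ -R` to height `≥ R`). -/
def SeparatesEnds (A : Set E6) : Prop :=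
  ∃ R : ℝ, ∀ a b : E6, a ∈ cylN → b ∈ cylN → a 5 ≤ -R → R ≤ b 5 → ¬ JoinedIn (cylN \ A) a b

/-- **Extrinsic Reifenberg flatness** of `A ⊆ ℝ⁶` with constant `δ` at all scales `≤ r₀`: for every centre `x ∈ A`
and radius `0 < r ≤ r₀` there is a 4-dimensional linear subspace `L` such that `A ∩ B_r(x)` and `(x + L) ∩ B_r(x)` are
`δ r`-Hausdorff close (two-sided). For `A ⊆ N` and `r₀ ≪ 1` the plane is automatically almost tangent to `N`. -/
def IsReifFlat (A : Set E6) (δ r₀ : ℝ) : Prop :=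
  ∀ x ∈ A, ∀ r : ℝ, 0 < r → r ≤ r₀ →
    ∃ L : Submodule ℝ E6, Module.finrank ℝ L = 4 ∧
      (∀ z ∈ A, dist z x ≤ r → ∃ w ∈ L, dist z (x + w) ≤ δ * r) ∧
      (∀ w ∈ L, ‖w‖ ≤ r → ∃ z ∈ A, dist z (x + w) ≤ δ * r)

/-- **Hausdorff closeness to a slice**: `A` lies in the slab `|z₅ - t₀| ≤ η` and every point of the slice
`S⁴ × {t₀}` is within `η` of `A`. -/
def NearSlice (A : Set E6) (η : ℝ) : Prop :=
  ∃ t₀ : ℝ, (∀ z ∈ A, |z 5 - t₀| ≤ η) ∧ (∀ q ∈ cylN, q 5 = t₀ → ∃ z ∈ A, dist z q ≤ η)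

/-- **Lower density bound** (Ahlfors regularity from below) of `A ⊆ ℝ⁶` at scales `≤ r₀` with constant `c`. -/
def LowerDense (A : Set E6) (c r₀ : ℝ) : Prop :=
  ∀ x ∈ A, ∀ r : ℝ, 0 < r → r ≤ r₀ → ENNReal.ofReal (c * r ^ 4) ≤ μH[4] (A ∩ Metric.ball x r)

/-- **F4 — SMOOTH REIFENBERG RECOGNITION (the lever).** Universal `δ₀, r₀, η₀ > 0`: every closed connected smooth
4-manifold `M`, smoothly embedded in `N = S⁴ × ℝ ⊂ ℝ⁶` with image `δ₀`-Reifenberg flat at all scales `≤ r₀` and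
`η₀`-Hausdorff close to a slice, is diffeomorphic to `S⁴`. (Reifenberg's multiscale parametrisation started from the
slice, whose steps are diffeomorphisms between the smooth intermediate surfaces, STOPPED at the scale below which
`range ι` is a `C¹`-small graph over its tangent planes; the homotopy type of `M` is not used.) -/
def SmoothReifenbergRecognition : Prop :=
  ∃ δ₀ r₀ η₀ : ℝ, 0 < δ₀ ∧ 0 < r₀ ∧ 0 < η₀ ∧
    ∀ (M : Type) [TopologicalSpace M] [T2Space M] [SecondCountableTopology M]
      [ChartedSpace (EuclideanSpace ℝ (Fin 4)) M] [IsManifold (𝓡 4) ∞ M] [CompactSpace M] [ConnectedSpace M]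
      (ι : M → E6), Manifold.IsSmoothEmbedding (𝓡 4) (𝓡 6) ∞ ι → Set.range ι ⊆ cylN →
      IsReifFlat (Set.range ι) δ₀ r₀ → NearSlice (Set.range ι) η₀ →
      Nonempty (M ≃ₘ⟮𝓡 4, 𝓡 4⟯ Metric.sphere (0 : E5) 1)

/-- **F1a — ENTROPY ⇒ LOWER DENSITY.** Universal `ε₁, c₁, r₁ > 0`: a compact smoothly embedded hypersurface of `N` with
typed cylinder entropy `≤ 1 + ε₁` has `μH⁴(range ι ∩ B_r(x)) ≥ c₁ r⁴` at all its points and scales `r ≤ r₁`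
(thin films / tentacles are seen by OFF-surface centres: blow-up at the maximal median scale + equality in the
Gaussian isoperimetric inequality). -/
def EntropyLowerDensity : Prop :=
  ∃ ε₁ c₁ r₁ : ℝ, 0 < ε₁ ∧ 0 < c₁ ∧ 0 < r₁ ∧
    ∀ (M : Type) [TopologicalSpace M] [T2Space M] [SecondCountableTopology M]
      [ChartedSpace (EuclideanSpace ℝ (Fin 4)) M] [IsManifold (𝓡 4) ∞ M] [CompactSpace M]
      (ι : M → E6), Manifold.IsSmoothEmbedding (𝓡 4) (𝓡 6) ∞ ι → Set.range ι ⊆ cylN →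
      cylEntropy (Set.range ι) ≤ ENNReal.ofReal (1 + ε₁) → LowerDense (Set.range ι) c₁ r₁

/-- **F1b — ENTROPY ⇒ REIFENBERG FLATNESS** (cylinder version of L. Chen 2021 Thm 1.4, claimed provable WITHOUT any
flow: BV compactness of the enclosed regions, Euclidean blow-ups, equality case of the Gaussian isoperimetric
inequality at median centres forces half-spaces, multiplicity one from `F̂ ≤ 1`, Hausdorff upgrade from F1a). -/
def EntropyFlatness : Prop :=
  ∀ δ : ℝ, 0 < δ → ∃ ε ρ : ℝ, 0 < ε ∧ 0 < ρ ∧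
    ∀ (M : Type) [TopologicalSpace M] [T2Space M] [SecondCountableTopology M]
      [ChartedSpace (EuclideanSpace ℝ (Fin 4)) M] [IsManifold (𝓡 4) ∞ M] [CompactSpace M]
      (ι : M → E6), Manifold.IsSmoothEmbedding (𝓡 4) (𝓡 6) ∞ ι → Set.range ι ⊆ cylN →
      cylEntropy (Set.range ι) ≤ ENNReal.ofReal (1 + ε) → IsReifFlat (Set.range ι) δ ρ

/-- **F2 — SLAB CONFINEMENT** (Hausdorff stability of the slice among cross-sections): area budget
`vol S⁴ ≤ μH⁴(range ι) ≤ (1+ε) vol S⁴` (tree: `hausdorffMeasure_sphere_le_of_separatesEnds`,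
`measure_ratio_le_cylEntropy`) + almost-monotonicity of the cross-sectional volume of the lower region (flux of `∂_s`)
+ isoperimetry on `S⁴` + coarea + the lower density bound F1a. -/
def SlabConfinement : Prop :=
  ∀ η : ℝ, 0 < η → ∃ ε : ℝ, 0 < ε ∧
    ∀ (M : Type) [TopologicalSpace M] [T2Space M] [SecondCountableTopology M]
      [ChartedSpace (EuclideanSpace ℝ (Fin 4)) M] [IsManifold (𝓡 4) ∞ M] [CompactSpace M] [ConnectedSpace M]
      (ι : M → E6), Manifold.IsSmoothEmbedding (𝓡 4) (𝓡 6) ∞ ι → Set.range ι ⊆ cylN →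
      SeparatesEnds (Set.range ι) →
      cylEntropy (Set.range ι) ≤ ENNReal.ofReal (1 + ε) → NearSlice (Set.range ι) η

/-- **Transfer shape.** The three lemmas give the crux with `ε := min (ε(δ₀) of F1b, ε(η₀') of F2, ε₁)` (after
shrinking `r₀` to the flatness scale `ρ`); `M ≃ₕ S⁴` supplies `CompactSpace`/`ConnectedSpace`, the typed `∑ = 1` gives
`range ι ⊆ N`, the typed `⨆ < ofReal (1+ε)` is `cylEntropy (range ι) < ofReal (1+ε)` verbatim. Conclusion = the route
decl by name; the proof (instances + real-number bookkeeping) is crux-plan business. -/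
def FlatSandwichTransfer : Prop :=
  SmoothReifenbergRecognition → EntropyLowerDensity → EntropyFlatness → SlabConfinement →
    Summit.SmoothPoincare4.SmoothPoincare4.Theses.CylinderEntropy.SliceIsolation

end Summit.SmoothPoincare4.SmoothPoincare4.Cruxes.SliceIsolation.ReifenbergStopping
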